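/-
Copyright (c) 2026. Released under Apache 2.0 license.
-/
import Summits.RiemannHypothesis.RiemannHypothesis.Theorems.MotivicDoorSemilocalQuinticCells
import HarnessLib

/-!
# Semi-local `{∞,2}` ladder — the killing integral with a tail credit (sharper lower bound on `C₂`)

Cell `rh-explicit`, seat `cc-s2-3` (draft for `cc-s2-4`'s landing of the exact Markov witnesses at
`b = 0.558 … 0.5574`, EXTREMALS/S2-05574, S2-0558).

`MotivicDoorSemilocalQuinticCells.kSum_le_killing` bounds the killing integral
`K = ∫₀^∞ (e^{t/2} − 1)/(2 sinh t) dt = Σ_{m ≥ 0} 1/((4m+1)(2m+1))` from below by the partial sum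
`kSum 200`, dropping the whole remainder (≈ 6.25·10⁻⁴, hence `const_le_semilocalTwoConstant` is
≈ 1.26·10⁻³ below `C₂`).  The remainder is explicit: with `s = e^{−t/2}`,
`(e^{t/2} − 1)/(2 sinh t) = (s − s²)/(1 − s⁴)` and `(s − s²)(s⁴)^M/(1 − s⁴) ≥ ¼·s^{4M+1}` because
`1 − s⁴ = (1 − s)(1 + s + s² + s³) ≤ 4(1 − s)` on `(0,1)`.  Integrating the sharper pointwise
minorant gives `kSum M + 1/(8M+2) ≤ K` for every `M`, and with `M = 200` the constant bound
`4.0884869 + 2·kSum 200 + 2/1602 ≤ C₂` (residual ≈ 2.3·10⁻⁶ instead of 1.26·10⁻³).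

PROVED here: everything stated; nothing is specific to RH.
-/

set_option linter.dupNamespace false

noncomputable section

open MeasureTheory Set Filter Topology Real Finset
open Literature.NumberTheory.LFunctions

namespace Summit.RiemannHypothesis.RiemannHypothesis.Theorems.MotivicDoor.SemilocalQuintic

open SemilocalMarkov SemilocalKernel

/-- Sharper pointwise minorant of the killing density with the geometric tail credited:
`Σ_{m<M} (e^{-(2m+½)t} − e^{-(2m+1)t}) + ¼ e^{-(2M+½)t} ≤ (e^{t/2} − 1)/(2 sinh t)` for `t > 0`. -/
theorem killing_minorant_tail (M : ℕ) {t : ℝ} (ht : 0 < t) :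
    ∑ m ∈ range M, (Real.exp (-(2 * m + 1 / 2) * t) - Real.exp (-(2 * m + 1) * t))
      + 1 / 4 * Real.exp (-(2 * M + 1 / 2) * t)
      ≤ (Real.exp (t / 2) - 1) / (2 * Real.sinh t) := by
  set s := Real.exp (-(t / 2)) with hs
  have hs0 : 0 < s := Real.exp_pos _
  have hs1 : s < 1 := Real.exp_lt_one_iff.2 (by linarith)
  have hq0 : 0 < s ^ 4 := by positivity
  have hq1 : s ^ 4 < 1 := pow_lt_one₀ hs0.le hs1 (by norm_num)
  have hterm : ∀ m : ℕ, Real.exp (-(2 * m + 1 / 2) * t) - Real.exp (-(2 * m + 1) * t)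
      = (s - s ^ 2) * (s ^ 4) ^ m := by
    intro m
    have a : Real.exp (-(2 * m + 1 / 2) * t) = s ^ (4 * m + 1) := by
      rw [hs, ← Real.exp_nat_mul]; congr 1; push_cast; ring
    have b : Real.exp (-(2 * m + 1) * t) = s ^ (4 * m + 2) := by
      rw [hs, ← Real.exp_nat_mul]; congr 1; push_cast; ring
    rw [a, b]; ring
  have htail : Real.exp (-(2 * M + 1 / 2) * t) = s * (s ^ 4) ^ M := by
    have a : Real.exp (-(2 * M + 1 / 2) * t) = s ^ (4 * M + 1) := by
      rw [hs, ← Real.exp_nat_mul]; congr 1; push_cast; ring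
    rw [a]; ring
  simp_rw [hterm]
  rw [← Finset.mul_sum, htail]
  have h1q : (1 : ℝ) - s ^ 4 ≠ 0 := (sub_pos.2 hq1).ne'
  have hgeom : ∑ m ∈ range M, (s ^ 4) ^ m = (1 - (s ^ 4) ^ M) / (1 - s ^ 4) := by
    rw [eq_div_iff h1q, geom_sum_mul_neg]
  have hrhs : (Real.exp (t / 2) - 1) / (2 * Real.sinh t) = (s - s ^ 2) * (1 / (1 - s ^ 4)) := by
    rw [Real.sinh_eq]
    have e1 : Real.exp (t / 2) = s⁻¹ := by rw [hs, Real.exp_neg, inv_inv]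
    have e2 : Real.exp t = (s ^ 2)⁻¹ := by
      rw [hs, ← Real.exp_nat_mul, ← Real.exp_neg]; congr 1; push_cast; ring
    have e3 : Real.exp (-t) = s ^ 2 := by
      rw [hs, ← Real.exp_nat_mul]; congr 1; push_cast; ring
    rw [e1, e2, e3]
    field_simp
  rw [hrhs, hgeom]
  -- goal: (s - s²)·(1 - q^M)/(1 - q) + ¼·(s·q^M) ≤ (s - s²)·(1/(1 - q)),  q = s⁴
  have hqM : 0 ≤ (s ^ 4) ^ M := by positivity
  have hkey : 1 / 4 * (s * (s ^ 4) ^ M) ≤ (s - s ^ 2) * ((s ^ 4) ^ M / (1 - s ^ 4)) := by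
    rw [mul_div_assoc', le_div_iff₀ (sub_pos.2 hq1)]
    -- ¼ s q^M (1 - s⁴) ≤ (s - s²) q^M  ⟸  (1 - s⁴) ≤ 4 (1 - s)
    have h4 : 1 - s ^ 4 ≤ 4 * (1 - s) := by
      have hs2 : s ^ 2 < 1 := pow_lt_one₀ hs0.le hs1 (by norm_num)
      have hs3 : s ^ 3 < 1 := pow_lt_one₀ hs0.le hs1 (by norm_num)
      have key : 4 * (1 - s) - (1 - s ^ 4) = (1 - s) * (3 - s - s ^ 2 - s ^ 3) := by ring
      have hnn : 0 ≤ (1 - s) * (3 - s - s ^ 2 - s ^ 3) :=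
        mul_nonneg (by linarith) (by linarith)
      linarith [key, hnn]
    have : 0 ≤ s * (s ^ 4) ^ M := by positivity
    nlinarith [this, h4]
  have hsplit : (s - s ^ 2) * (1 / (1 - s ^ 4))
      = (s - s ^ 2) * ((1 - (s ^ 4) ^ M) / (1 - s ^ 4)) + (s - s ^ 2) * ((s ^ 4) ^ M / (1 - s ^ 4)) := by
    field_simp
    ring
  rw [hsplit]
  linarith [hkey]

/-- The killing integral with the tail credited: `K_M + 1/(8M+2) ≤ ∫₀^∞ (e^{t/2} − 1)/(2 sinh t) dt`. -/
theorem kSum_add_tail_le_killing (M : ℕ) :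
    kSum M + 1 / (8 * M + 2) ≤ ∫ t in Ioi (0 : ℝ), (Real.exp (t / 2) - 1) / (2 * Real.sinh t) := by
  have hint : ∀ m : ℕ, IntegrableOn (fun t ↦ Real.exp (-(2 * m + 1 / 2) * t)
      - Real.exp (-(2 * m + 1) * t)) (Ioi (0 : ℝ)) := fun m ↦
    (exp_neg_integrableOn_Ioi 0 (by positivity)).sub (exp_neg_integrableOn_Ioi 0 (by positivity))
  have htl : IntegrableOn (fun t ↦ 1 / 4 * Real.exp (-(2 * M + 1 / 2) * t)) (Ioi (0 : ℝ)) :=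
    (exp_neg_integrableOn_Ioi 0 (by positivity)).const_mul _
  have hmi : IntegrableOn (fun t ↦ ∑ m ∈ range M, (Real.exp (-(2 * m + 1 / 2) * t)
      - Real.exp (-(2 * m + 1) * t)) + 1 / 4 * Real.exp (-(2 * M + 1 / 2) * t)) (Ioi (0 : ℝ)) :=
    (integrable_finsetSum _ fun m _ ↦ hint m).add htl
  have hmono := setIntegral_mono_on hmi integrableOn_weilKillingDensity measurableSet_Ioi
    fun t ht ↦ killing_minorant_tail M ht
  refine le_trans (le_of_eq ?_) hmono
  rw [integral_add (integrable_finsetSum _ fun m _ ↦ hint m) htl,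
    integral_finsetSum _ fun m _ ↦ hint m, kSum, integral_const_mul,
    integral_exp_mul_Ioi (by have := M.cast_nonneg (α := ℝ); linarith : -(2 * (M : ℝ) + 1 / 2) < 0)]
  simp only [mul_zero, Real.exp_zero]
  congr 1
  · refine Finset.sum_congr rfl fun m _ ↦ ?_
    rw [integral_sub (exp_neg_integrableOn_Ioi 0 (by positivity))
      (exp_neg_integrableOn_Ioi 0 (by positivity)),
      integral_exp_mul_Ioi (by have := m.cast_nonneg (α := ℝ); linarith : -(2 * (m : ℝ) + 1 / 2) < 0),
      integral_exp_mul_Ioi (by have := m.cast_nonneg (α := ℝ); linarith : -(2 * (m : ℝ) + 1) < 0)]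
    simp only [mul_zero, Real.exp_zero]
    have h1 : (4 * (m : ℝ) + 1) ≠ 0 := by positivity
    have h2 : (2 * (m : ℝ) + 1) ≠ 0 := by positivity
    have h3 : (2 * (m : ℝ) + 1 / 2) ≠ 0 := by positivity
    field_simp
    ring
  · have h3 : (2 * (M : ℝ) + 1 / 2) ≠ 0 := by positivity
    have h4 : (8 * (M : ℝ) + 2) ≠ 0 := by positivity
    field_simp
    ring

/-- **Sharper constant bound**: `4.0884869 + 2 K_200 + 2/1602 ≤ C₂ = √2 log 2 + log 4π + γ + 2K`
(residual ≈ 2.3·10⁻⁶; the tree's `const_le_semilocalTwoConstant` is the same without `2/1602`). -/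
theorem const_add_tail_le_semilocalTwoConstant :
    (40884869 / 10000000 : ℝ) + 2 * kSum 200 + 2 / 1602 ≤ semilocalTwoConstant := by
  have hK := kSum_add_tail_le_killing 200
  have h1 := JensenWindow.sqrt_two_mul_log_two_ge
  have h2 := JensenWindow.log_pi_ge_d5
  have h3 := Literature.Analysis.SpecialFunctions.Real.eulerMascheroniConstant_gt_d8
  have h4 := Real.log_two_gt_d9
  have e1 : 2 * (Real.log 2 / Real.sqrt 2) = Real.sqrt 2 * Real.log 2 := by
    have hs : Real.sqrt 2 * Real.sqrt 2 = 2 := Real.mul_self_sqrt (by norm_num)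
    have hs0 : Real.sqrt 2 ≠ 0 := by positivity
    field_simp
    nlinarith [hs]
  have e2 : Real.log (4 * π) = 2 * Real.log 2 + Real.log π := by
    rw [Real.log_mul (by norm_num) Real.pi_pos.ne', show (4 : ℝ) = 2 ^ 2 by norm_num,
      Real.log_pow]; push_cast; ring
  have e3 : (1 : ℝ) / (8 * ((200 : ℕ) : ℝ) + 2) = 1 / 1602 := by norm_num
  rw [e3] at hK
  unfold semilocalTwoConstant
  rw [e1, e2]
  linarith

/-- The same with a general truncation order `M` (for sharper instances, e.g. `M = 1000` leaves a
residual `≈ 9·10⁻⁸`): `4.0884869 + 2 K_M + 2/(8M+2) ≤ C₂`. -/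
theorem const_add_tail_le_semilocalTwoConstant' (M : ℕ) :
    (40884869 / 10000000 : ℝ) + 2 * kSum M + 2 / (8 * M + 2) ≤ semilocalTwoConstant := by
  have hK := kSum_add_tail_le_killing M
  have h1 := JensenWindow.sqrt_two_mul_log_two_ge
  have h2 := JensenWindow.log_pi_ge_d5
  have h3 := Literature.Analysis.SpecialFunctions.Real.eulerMascheroniConstant_gt_d8
  have h4 := Real.log_two_gt_d9
  have e1 : 2 * (Real.log 2 / Real.sqrt 2) = Real.sqrt 2 * Real.log 2 := by
    have hs : Real.sqrt 2 * Real.sqrt 2 = 2 := Real.mul_self_sqrt (by norm_num)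
    have hs0 : Real.sqrt 2 ≠ 0 := by positivity
    field_simp
    nlinarith [hs]
  have e2 : Real.log (4 * π) = 2 * Real.log 2 + Real.log π := by
    rw [Real.log_mul (by norm_num) Real.pi_pos.ne', show (4 : ℝ) = 2 ^ 2 by norm_num,
      Real.log_pow]; push_cast; ring
  have e3 : (2 : ℝ) / (8 * M + 2) = 2 * (1 / (8 * M + 2)) := by ring
  unfold semilocalTwoConstant
  rw [e1, e2, e3]
  linarith

end Summit.RiemannHypothesis.RiemannHypothesis.Theorems.MotivicDoor.SemilocalQuintic

end
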